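import Literature.Combinatorics.Hypergraph.FGKMTCoveringNibbleStep
import HarnessLib

/-!
# Ford–Green–Konyagin–Maynard–Tao 2018, Theorem 3 (probabilistic covering) — PROVED (`C₀ = 10`)

Topic `Literature/Combinatorics/Hypergraph`. Source: K. Ford, B. Green, S. Konyagin, J. Maynard, T. Tao,
*Long gaps between primes*, J. Amer. Math. Soc. 31 (2018) 65–105 = arXiv:1412.5029
[FordGreenKonyaginMaynardTao2018], Theorem 3 p. 11 and its proof, §5 pp. 19–21 (arXiv pp. 14–16):
«We induct on `m`. When `m = 0` there is nothing to prove … define `𝐖` by (5.1) … draw the `𝐞'_i`,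
`i ∈ I_m`, independently given `𝐖` with the laws (5.3) …».

This file PROVES the named fact `FGKMT2018_theorem3` of `FGKMTProbabilisticCovering` (there stated as a
`def … : Prop`) with the explicit constant `C₀ = 10`: `fgkmt2018_theorem3 : FGKMT2018_theorem3`.
Contents: the extension of a configuration law by one block of conditionally independent coordinates
(`extend`, master identity `sum_extend_mul`), the bundled level-`m` hypotheses/conclusion
(`LevelHyps`, `LevelConcl`), the sieved set `𝐖` (5.1) as a function of the configuration off `I_m`
(`Wb`), the numerology of (4.5) (`wPar`, `Gpar`, `smallness`: with `w = δ^{1/(3·10^{m+2})}` one has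
`η = δ^{1/10^m} = w^{300}`, `G w³ ≤ 1/10`, `20G³w^{50} ≤ w^{30} = δ^{1/10^{m+1}}`), the nibble at level
`m` as a `NibbleData` (`mkNibble`), the inductive step (`levelConcl_succ`, using `NibbleData.step`; the
degenerate case `A < 2rm` puts `𝐞'_i = ∅`), the base case, and the induction.

Together with `FGKMT2018Corollary3Proof` (Theorem 3 ⟹ Corollary 3) and `FGKMT2018Theorem4Proof`
(Theorem 5 ⟹ Theorem 4 ⟹ … ⟹ Theorem 1), this leaves Theorem 5 (§§6–8, concentration of the sieve
weights) as the only named input for `RankinConstant κ` for every `κ`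
(`rankinConstant_of_fgkmt2018_theorem3_theorem5`).
-/

noncomputable section

open Finset

namespace Literature.Combinatorics.Hypergraph

namespace FGKMTCovering

/-! ## §5, the induction on `m`: extending a configuration law by one block

The previous-stage law `Λ'` on configurations `ω : ι → Finset V` is extended to the block `T = I_m` by
independent conditional laws `Q b i` (`i ∈ T`) depending only on the part `b` of the configuration off
`T` (through `𝐖 = 𝐖(b)`).
-/

section Extend

variable {V ι : Type*} [Fintype V] [Fintype ι] [DecidableEq ι]

/-- Split a configuration `ω : ι → Finset V` into its part on `T` and its part off `T`.
[cite: FordGreenKonyaginMaynardTao2018, §5 (the variables `𝐞_i, i ∈ I_m` vs. `⋃_{j<m} I_j`)] -/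
def split (T : Finset ι) :
    (ι → Finset V) ≃ ({x // x ∈ T} → Finset V) × ({x // x ∉ T} → Finset V) :=
  Equiv.piEquivPiSubtypeProd (· ∈ T) (fun _ => Finset V)

variable (T : Finset ι)

omit [Fintype V] [Fintype ι] in
/-- [cite: FordGreenKonyaginMaynardTao2018, §5] -/
@[simp] theorem split_symm_apply_mem (a : {x // x ∈ T} → Finset V) (b : {x // x ∉ T} → Finset V)
    {i : ι} (hi : i ∈ T) : (split T).symm (a, b) i = a ⟨i, hi⟩ := by
  simp [split, hi]

omit [Fintype V] [Fintype ι] in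
/-- [cite: FordGreenKonyaginMaynardTao2018, §5] -/
@[simp] theorem split_symm_apply_not_mem (a : {x // x ∈ T} → Finset V)
    (b : {x // x ∉ T} → Finset V) {i : ι} (hi : i ∉ T) : (split T).symm (a, b) i = b ⟨i, hi⟩ := by
  simp [split, hi]

omit [Fintype V] [Fintype ι] in
/-- [cite: FordGreenKonyaginMaynardTao2018, §5] -/
@[simp] theorem split_snd_apply (ω : ι → Finset V) (x : {x // x ∉ T}) : (split T ω).2 x = ω x.1 := rfl

omit [Fintype V] [Fintype ι] in
/-- [cite: FordGreenKonyaginMaynardTao2018, §5] -/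
@[simp] theorem split_fst_apply (ω : ι → Finset V) (x : {x // x ∈ T}) : (split T ω).1 x = ω x.1 := rfl

omit [Fintype V] [Fintype ι] in
/-- [cite: FordGreenKonyaginMaynardTao2018, §5] -/
@[simp] theorem split_split_symm_snd (a : {x // x ∈ T} → Finset V) (b : {x // x ∉ T} → Finset V) :
    (split T ((split T).symm (a, b))).2 = b := by
  rw [Equiv.apply_symm_apply]

/-- `∑_ω f(ω) = ∑_b ∑_a f(a, b)`. [cite: FordGreenKonyaginMaynardTao2018, §5] -/
theorem sum_split (f : (ι → Finset V) → ℝ) :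
    ∑ ω, f ω = ∑ b, ∑ a, f ((split T).symm (a, b)) := by
  rw [← (split T).symm.sum_comp f, Fintype.sum_prod_type, Finset.sum_comm]

/-- The marginal of `Λ'` on the coordinates off `T`. [cite: FordGreenKonyaginMaynardTao2018, §5] -/
def margT (Λ' : (ι → Finset V) → ℝ) (b : {x // x ∉ T} → Finset V) : ℝ :=
  ∑ a, Λ' ((split T).symm (a, b))

/-- The extended law `Λ(ω) = Λ'_{off T}(b) ∏_{i ∈ T} Q_b,i(ω_i)` (the `𝐞'_i`, `i ∈ I_m`, drawn independently
given `𝐖`). [cite: FordGreenKonyaginMaynardTao2018, §5 (definition of the `𝐞'_i` after (5.3))] -/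
def extend (Λ' : (ι → Finset V) → ℝ) (Q : ({x // x ∉ T} → Finset V) → ι → Finset V → ℝ)
    (ω : ι → Finset V) : ℝ :=
  margT T Λ' (split T ω).2 * ∏ i ∈ T, Q (split T ω).2 i (ω i)

/-- [cite: FordGreenKonyaginMaynardTao2018, §5] -/
theorem sum_margT (Λ' : (ι → Finset V) → ℝ) : ∑ b, margT T Λ' b = ∑ ω, Λ' ω := by
  rw [sum_split T]; rfl

omit [Fintype ι] in
/-- [cite: FordGreenKonyaginMaynardTao2018, §5] -/
theorem margT_nonneg {Λ' : (ι → Finset V) → ℝ} (hΛ : ∀ ω, 0 ≤ Λ' ω) (b : {x // x ∉ T} → Finset V) :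
    0 ≤ margT T Λ' b :=
  Finset.sum_nonneg fun _ _ => hΛ _

/-- [cite: FordGreenKonyaginMaynardTao2018, §5] -/
theorem margT_isLaw {Λ' : (ι → Finset V) → ℝ} (hΛ : IsLaw Λ') : IsLaw (margT T Λ') :=
  ⟨margT_nonneg T hΛ.1, by rw [sum_margT, hΛ.2]⟩

/-- **Master identity:** `∑_ω Λ(ω) g(b) ∏_{i∈T} h_i(ω_i) = ∑_b Λ'_{off T}(b) g(b) ∏_{i∈T} ∑_S Q_b,i(S) h_i(S)`.
[cite: FordGreenKonyaginMaynardTao2018, §5 (conditional independence of the `𝐞'_i` given `𝐖`)] -/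
theorem sum_extend_mul (Λ' : (ι → Finset V) → ℝ) (Q : ({x // x ∉ T} → Finset V) → ι → Finset V → ℝ)
    (g : ({x // x ∉ T} → Finset V) → ℝ) (h : ι → Finset V → ℝ) :
    ∑ ω, extend T Λ' Q ω * (g (split T ω).2 * ∏ i ∈ T, h i (ω i)) =
      ∑ b, margT T Λ' b * g b * ∏ i ∈ T, ∑ S, Q b i S * h i S := by
  rw [sum_split T]
  refine Finset.sum_congr rfl fun b _ => ?_
  have hprod : ∀ a : {x // x ∈ T} → Finset V,
      (∏ i ∈ T, Q b i ((split T).symm (a, b) i)) * ∏ i ∈ T, h i ((split T).symm (a, b) i) =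
        ∏ i : {x // x ∈ T}, (Q b i (a i) * h i (a i)) := by
    intro a
    rw [← Finset.prod_mul_distrib, ← Finset.prod_coe_sort T]
    refine Finset.prod_congr rfl fun i _ => ?_
    rw [split_symm_apply_mem T a b i.2]
  calc ∑ a, extend T Λ' Q ((split T).symm (a, b)) *
        (g (split T ((split T).symm (a, b))).2 * ∏ i ∈ T, h i ((split T).symm (a, b) i))
      = margT T Λ' b * g b * ∑ a : {x // x ∈ T} → Finset V,
          ∏ i : {x // x ∈ T}, (Q b i (a i) * h i (a i)) := by
        rw [Finset.mul_sum]
        refine Finset.sum_congr rfl fun a _ => ?_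
        rw [← hprod a, extend, split_split_symm_snd]; ring
    _ = margT T Λ' b * g b * ∏ i : {x // x ∈ T}, ∑ S, Q b i S * h i S := by
        rw [Fintype.prod_sum (fun (i : {x // x ∈ T}) (S : Finset V) => Q b i S * h i S)]
    _ = margT T Λ' b * g b * ∏ i ∈ T, ∑ S, Q b i S * h i S := by
        rw [Finset.prod_coe_sort T (fun i => ∑ S, Q b i S * h i S)]

/-- The extended law is a probability law when the `Q_b,i` are.
[cite: FordGreenKonyaginMaynardTao2018, §5] -/
theorem extend_isLaw {Λ' : (ι → Finset V) → ℝ} (hΛ : IsLaw Λ')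
    {Q : ({x // x ∉ T} → Finset V) → ι → Finset V → ℝ} (hQ : ∀ b, ∀ i ∈ T, IsLaw (Q b i)) :
    IsLaw (extend T Λ' Q) := by
  refine ⟨fun ω => mul_nonneg (margT_nonneg T hΛ.1 _)
    (Finset.prod_nonneg fun i hi => (hQ _ i hi).1 _), ?_⟩
  have h := sum_extend_mul T Λ' Q (fun _ => 1) (fun _ _ => 1)
  simp only [mul_one, Finset.prod_const_one] at h
  rw [h]
  have h2 : ∀ b, ∏ i ∈ T, ∑ S, Q b i S = 1 := fun b =>
    Finset.prod_eq_one fun i hi => (hQ b i hi).2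
  simp only [h2, mul_one]
  rw [sum_margT, hΛ.2]

/-- Mass of an event of the form `{g(b) = 1} ∩ ⋂_{i∈T} {h_i(ω_i) = 1}` under the extended law.
[cite: FordGreenKonyaginMaynardTao2018, §5] -/
theorem sum_extend_filter (Λ' : (ι → Finset V) → ℝ) (Q : ({x // x ∉ T} → Finset V) → ι → Finset V → ℝ)
    (E : (ι → Finset V) → Prop) [DecidablePred E] (gB : ({x // x ∉ T} → Finset V) → Prop)
    [DecidablePred gB] (hP : ι → Finset V → Prop) [∀ i, DecidablePred (hP i)]
    (hE : ∀ ω, E ω ↔ gB (split T ω).2 ∧ ∀ i ∈ T, hP i (ω i)) :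
    ∑ ω ∈ univ.filter E, extend T Λ' Q ω =
      ∑ b, margT T Λ' b * (if gB b then 1 else 0) *
        ∏ i ∈ T, ∑ S, Q b i S * (if hP i S then 1 else 0) := by
  rw [← sum_extend_mul, Finset.sum_filter]
  refine Finset.sum_congr rfl fun ω _ => ?_
  rw [Finset.prod_boole]
  by_cases h1 : gB (split T ω).2
  · by_cases h2 : ∀ i ∈ T, hP i (ω i)
    · rw [if_pos ((hE ω).2 ⟨h1, h2⟩), if_pos h1, if_pos h2]; ring
    · rw [if_neg (fun h => h2 ((hE ω).1 h).2), if_pos h1, if_neg h2]; ring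
  · rw [if_neg (fun h => h1 ((hE ω).1 h).1), if_neg h1]; ring

end Extend

/-! ## §5, the induction on `m`: hypotheses and conclusion at level `m`, the sieved set `𝐖` -/

section Levels

variable {V ι : Type*} [Fintype V] [DecidableEq V] [Fintype ι] [DecidableEq ι]

/-- The hypotheses of Theorem 3 at level `m` (with `C₀ = 10`), bundled.
[cite: FordGreenKonyaginMaynardTao2018, Theorem 3, (4.5)–(4.13)] -/
structure LevelHyps (D r A κ δ : ℝ) (I : ℕ → Finset ι) (μ : ι → Finset V → ℝ) (m : ℕ) : Prop where
  hD : 1 ≤ D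
  hr : 1 ≤ r
  hA : 1 ≤ A
  hκ0 : 0 < κ
  hκ : κ ≤ 1 / 2
  hδ : 0 < δ
  hsmall : δ ≤ (κ ^ A / (10 * Real.exp (A * D))) ^ (10 ^ (m + 2) : ℕ)
  hne : ∀ j ∈ Finset.Icc 1 m, (I j).Nonempty
  hdisj : ∀ j₁ ∈ Finset.Icc 1 m, ∀ j₂ ∈ Finset.Icc 1 m, j₁ ≠ j₂ → Disjoint (I j₁) (I j₂)
  hlaw : ∀ j ∈ Finset.Icc 1 m, ∀ i ∈ I j, IsLaw (μ i)
  hsize : ∀ j ∈ Finset.Icc 1 m, ∀ i ∈ I j, ∀ S : Finset V, μ i S ≠ 0 → (#S : ℝ) ≤ r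
  hsparse : ∀ j ∈ Finset.Icc 1 m, ∀ i ∈ I j, ∀ v : V, probMem (μ i) v ≤ δ / Real.sqrt (#(I j) : ℝ)
  hcodeg : ∀ j ∈ Finset.Icc 1 m, ∀ v₁ v₂ : V, v₁ ≠ v₂ → ∑ i ∈ I j, probPairMem (μ i) v₁ v₂ ≤ δ
  hdeg : ∀ j ∈ Finset.Icc 1 m, ∀ v : V, normDegree μ (I j) v ≤ D * levelProb μ I (j - 1) v
  hκp : ∀ j ≤ m, ∀ v : V, κ ≤ levelProb μ I j v

/-- The conclusion of Theorem 3 at level `m`: a configuration law with (a) and (b).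
[cite: FordGreenKonyaginMaynardTao2018, Theorem 3 (a), (b) = (4.14)] -/
def LevelConcl (r A δ : ℝ) (I : ℕ → Finset ι) (μ : ι → Finset V → ℝ) (m : ℕ) : Prop :=
  ∃ Λ : (ι → Finset V) → ℝ, IsLaw Λ ∧
    (∀ ω, Λ ω ≠ 0 → ∀ j ∈ Finset.Icc 1 m, ∀ i ∈ I j, ω i = ∅ ∨ μ i (ω i) ≠ 0) ∧
    (∀ J ≤ m, ∀ e : Finset V, (#e : ℝ) ≤ A - 2 * r * J →
      |(∑ ω ∈ (univ : Finset (ι → Finset V)).filter (fun ω => AvoidsLevels I J e ω), Λ ω)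
          - levelProbSet μ I J e|
        ≤ δ ^ (1 / (10 : ℝ) ^ (J + 1)) * levelProbSet μ I J e)

variable {D r A κ δ : ℝ} {I : ℕ → Finset ι} {μ : ι → Finset V → ℝ}

/-- The base quantity `x₀ = κ^A/(10 e^{AD})` of (4.5) lies in `(0, 1]`.
[cite: FordGreenKonyaginMaynardTao2018, (4.5)] -/
theorem x0_pos_le_one (hD : 1 ≤ D) (hA : 1 ≤ A) (hκ0 : 0 < κ) (hκ : κ ≤ 1 / 2) :
    0 < κ ^ A / (10 * Real.exp (A * D)) ∧ κ ^ A / (10 * Real.exp (A * D)) ≤ 1 := by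
  have h1 : 0 < κ ^ A := Real.rpow_pos_of_pos hκ0 A
  have h2 : κ ^ A ≤ 1 := Real.rpow_le_one hκ0.le (by linarith) (by linarith)
  have h3 : 1 ≤ 10 * Real.exp (A * D) := by
    have hAD : 0 ≤ A * D := by positivity
    nlinarith [Real.add_one_le_exp (A * D)]
  refine ⟨by positivity, ?_⟩
  rw [div_le_one (by positivity)]
  linarith

omit [Fintype ι] [DecidableEq ι] in
/-- The hypotheses at level `m + 1` imply those at level `m` ((4.5) is monotone in `m`).
[cite: FordGreenKonyaginMaynardTao2018, §5 (induction on `m`)] -/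
theorem LevelHyps.mono {m : ℕ} (H : LevelHyps (V := V) D r A κ δ I μ (m + 1)) :
    LevelHyps D r A κ δ I μ m := by
  have hsub : ∀ j ∈ Finset.Icc 1 m, j ∈ Finset.Icc 1 (m + 1) := fun j hj => by
    rw [Finset.mem_Icc] at hj ⊢; omega
  obtain ⟨hx0, hx1⟩ := x0_pos_le_one H.hD H.hA H.hκ0 H.hκ
  refine ⟨H.hD, H.hr, H.hA, H.hκ0, H.hκ, H.hδ, ?_, fun j hj => H.hne j (hsub j hj),
    fun j₁ h₁ j₂ h₂ => H.hdisj j₁ (hsub j₁ h₁) j₂ (hsub j₂ h₂), fun j hj => H.hlaw j (hsub j hj),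
    fun j hj => H.hsize j (hsub j hj), fun j hj => H.hsparse j (hsub j hj),
    fun j hj => H.hcodeg j (hsub j hj), fun j hj => H.hdeg j (hsub j hj),
    fun j hj => H.hκp j (by omega)⟩
  refine H.hsmall.trans (pow_le_pow_of_le_one hx0.le hx1 ?_)
  exact Nat.pow_le_pow_right (by norm_num) (by omega)

omit [Fintype ι] [DecidableEq ι] in
/-- `P_j(v) > 0`. [cite: FordGreenKonyaginMaynardTao2018, (4.10)–(4.11)] -/
theorem levelProb_pos (μ : ι → Finset V → ℝ) (I : ℕ → Finset ι) : ∀ (j : ℕ) (v : V), 0 < levelProb μ I j v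
  | 0, _ => by simp [levelProb]
  | j + 1, v => by
    rw [levelProb]
    exact mul_pos (levelProb_pos μ I j v) (Real.exp_pos _)

omit [Fintype ι] [DecidableEq ι] in
/-- `d_I(v) ≥ 0` for laws. [cite: FordGreenKonyaginMaynardTao2018, (4.9)] -/
theorem normDegree_nonneg_of {T : Finset ι} (h : ∀ i ∈ T, ∀ S, 0 ≤ μ i S) (v : V) :
    0 ≤ normDegree μ T v :=
  Finset.sum_nonneg fun i hi => probMem_nonneg (h i hi) v

omit [Fintype ι] [DecidableEq ι] in
/-- `P_j(v) ≤ 1` when the `𝐞_i`, `i ∈ I_1 ∪ … ∪ I_j`, have laws.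
[cite: FordGreenKonyaginMaynardTao2018, (4.10)–(4.11)] -/
theorem levelProb_le_one : ∀ (j : ℕ), (∀ j' ∈ Finset.Icc 1 j, ∀ i ∈ I j', ∀ S, 0 ≤ μ i S) →
    ∀ v : V, levelProb μ I j v ≤ 1
  | 0, _, _ => by simp [levelProb]
  | j + 1, h, v => by
    rw [levelProb]
    have h1 : levelProb μ I j v ≤ 1 := levelProb_le_one j (fun j' hj' => h j' (by
      rw [Finset.mem_Icc] at hj' ⊢; omega)) v
    have h2 : Real.exp (-(normDegree μ (I (j + 1)) v / levelProb μ I j v)) ≤ 1 := by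
      rw [Real.exp_le_one_iff, neg_nonpos]
      exact div_nonneg (normDegree_nonneg_of (h (j + 1) (by simp)) v) (levelProb_pos μ I j v).le
    have h0 := (levelProb_pos μ I j v).le
    nlinarith [Real.exp_pos (-(normDegree μ (I (j + 1)) v / levelProb μ I j v))]

omit [Fintype ι] [DecidableEq ι] in
/-- `P_{n+1}(e) = P_n(e) e^{−∑_{v∈e} d_{I_{n+1}}(v)/P_n(v)}`. [cite: FordGreenKonyaginMaynardTao2018, (4.11), (4.14)] -/
theorem levelProbSet_succ (n : ℕ) (e : Finset V) :
    levelProbSet μ I (n + 1) e = pw (levelProb μ I n) e *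
      Real.exp (-∑ v ∈ e, normDegree μ (I (n + 1)) v / levelProb μ I n v) := by
  rw [levelProbSet, pw, ← Finset.sum_neg_distrib, Real.exp_sum, ← Finset.prod_mul_distrib]
  refine Finset.prod_congr rfl fun v _ => ?_
  rw [levelProb]

variable (I) (n : ℕ)

/-- The sieved set `𝐖 = V ∖ ⋃_{j=1}^{n} ⋃_{i∈I_j} 𝐞'_i` as a function of the configuration off `I_{n+1}`.
[cite: FordGreenKonyaginMaynardTao2018, (5.1)] -/
def Wb (b : {x // x ∉ I (n + 1)} → Finset V) : Finset V :=
  univ.filter (fun v => ∀ j ∈ Finset.Icc 1 n, ∀ i ∈ I j,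
    v ∉ (split (I (n + 1))).symm (fun _ => ∅, b) i)

variable {I n}

omit [Fintype V] [DecidableEq V] [Fintype ι] in
/-- Avoidance up to level `J ≤ n` does not depend on the coordinates in `I_{n+1}`.
[cite: FordGreenKonyaginMaynardTao2018, §5] -/
theorem avoids_split_symm (hdisj : ∀ j ∈ Finset.Icc 1 n, Disjoint (I j) (I (n + 1))) {J : ℕ}
    (hJ : J ≤ n) (e : Finset V) (a a' : {x // x ∈ I (n + 1)} → Finset V)
    (b : {x // x ∉ I (n + 1)} → Finset V) :
    AvoidsLevels I J e ((split (I (n + 1))).symm (a, b)) ↔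
      AvoidsLevels I J e ((split (I (n + 1))).symm (a', b)) := by
  refine forall₂_congr fun v _ => forall₂_congr fun j hj => forall₂_congr fun i hi => ?_
  have hi' : i ∉ I (n + 1) := Finset.disjoint_left.1 (hdisj j (by
    rw [Finset.mem_Icc] at hj ⊢; omega)) hi
  rw [split_symm_apply_not_mem _ _ _ hi', split_symm_apply_not_mem _ _ _ hi']

/-- `e` avoids levels `≤ n` of `ω` iff `e ⊆ 𝐖(ω|_{off I_{n+1}})`. [cite: FordGreenKonyaginMaynardTao2018, (5.1)] -/
theorem avoids_iff_subset_Wb (hdisj : ∀ j ∈ Finset.Icc 1 n, Disjoint (I j) (I (n + 1)))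
    (e : Finset V) (ω : ι → Finset V) :
    AvoidsLevels I n e ω ↔ e ⊆ Wb I n (split (I (n + 1)) ω).2 := by
  simp only [Wb, Finset.subset_iff, Finset.mem_filter, Finset.mem_univ, true_and]
  refine forall₂_congr fun v _ => forall₂_congr fun j hj => forall₂_congr fun i hi => ?_
  have hi' : i ∉ I (n + 1) := Finset.disjoint_left.1 (hdisj j hj) hi
  rw [split_symm_apply_not_mem _ _ _ hi', split_snd_apply]

omit [Fintype V] [DecidableEq V] [Fintype ι] [DecidableEq ι] in
/-- Avoidance up to level `n + 1` = avoidance up to level `n` and avoidance of the block `I_{n+1}`.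
[cite: FordGreenKonyaginMaynardTao2018, §5] -/
theorem avoids_succ_iff (e : Finset V) (ω : ι → Finset V) :
    AvoidsLevels I (n + 1) e ω ↔ AvoidsLevels I n e ω ∧ ∀ i ∈ I (n + 1), ∀ v ∈ e, v ∉ ω i := by
  constructor
  · intro h
    refine ⟨fun v hv j hj i hi => h v hv j (by rw [Finset.mem_Icc] at hj ⊢; omega) i hi,
      fun i hi v hv => h v hv (n + 1) (by simp) i hi⟩
  · rintro ⟨h1, h2⟩ v hv j hj i hi
    rw [Finset.mem_Icc] at hj
    by_cases hjn : j ≤ n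
    · exact h1 v hv j (by rw [Finset.mem_Icc]; omega) i hi
    · have : j = n + 1 := by omega
      subst this
      exact h2 i hi v hv

omit [DecidableEq V] [Fintype ι] in
/-- **(a) for the extended law.** [cite: FordGreenKonyaginMaynardTao2018, Theorem 3 (a)] -/
theorem extend_support (hdisj : ∀ j ∈ Finset.Icc 1 n, Disjoint (I j) (I (n + 1)))
    {Λ' : (ι → Finset V) → ℝ}
    (ha : ∀ ω, Λ' ω ≠ 0 → ∀ j ∈ Finset.Icc 1 n, ∀ i ∈ I j, ω i = ∅ ∨ μ i (ω i) ≠ 0)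
    {Q : ({x // x ∉ I (n + 1)} → Finset V) → ι → Finset V → ℝ}
    (hQ : ∀ b, ∀ i ∈ I (n + 1), ∀ S, Q b i S ≠ 0 → S = ∅ ∨ μ i S ≠ 0)
    (ω : ι → Finset V) (hω : extend (I (n + 1)) Λ' Q ω ≠ 0) :
    ∀ j ∈ Finset.Icc 1 (n + 1), ∀ i ∈ I j, ω i = ∅ ∨ μ i (ω i) ≠ 0 := by
  intro j hj i hi
  rw [extend] at hω
  obtain ⟨h1, h2⟩ := mul_ne_zero_iff.1 hω
  rw [Finset.mem_Icc] at hj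
  by_cases hjn : j ≤ n
  · -- coordinates off the block: from Λ'
    obtain ⟨a, _, ha'⟩ := Finset.exists_ne_zero_of_sum_ne_zero h1
    have hi' : i ∉ I (n + 1) := Finset.disjoint_left.1 (hdisj j (by rw [Finset.mem_Icc]; omega)) hi
    have := ha _ ha' j (by rw [Finset.mem_Icc]; omega) i hi
    rwa [split_symm_apply_not_mem _ _ _ hi', split_snd_apply] at this
  · have : j = n + 1 := by omega
    subst this
    exact hQ _ i hi _ (Finset.prod_ne_zero_iff.1 h2 i hi)

/-- **(b) for `J ≤ n` under the extended law** = (b) for the previous law.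
[cite: FordGreenKonyaginMaynardTao2018, §5 («the case `0 ≤ J < m` follows from the induction hypothesis»)] -/
theorem sum_extend_avoids_of_le (hdisj : ∀ j ∈ Finset.Icc 1 n, Disjoint (I j) (I (n + 1)))
    (Λ' : (ι → Finset V) → ℝ) {Q : ({x // x ∉ I (n + 1)} → Finset V) → ι → Finset V → ℝ}
    (hQ : ∀ b, ∀ i ∈ I (n + 1), IsLaw (Q b i)) {J : ℕ} (hJ : J ≤ n) (e : Finset V) :
    ∑ ω ∈ univ.filter (fun ω => AvoidsLevels I J e ω), extend (I (n + 1)) Λ' Q ω =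
      ∑ ω ∈ univ.filter (fun ω => AvoidsLevels I J e ω), Λ' ω := by
  let gB : ({x // x ∉ I (n + 1)} → Finset V) → Prop :=
    fun b => AvoidsLevels I J e ((split (I (n + 1))).symm (fun _ => ∅, b))
  have hE : ∀ ω : ι → Finset V,
      AvoidsLevels I J e ω ↔ gB (split (I (n + 1)) ω).2 ∧ ∀ i ∈ I (n + 1), True := by
    intro ω
    simp only [gB, imp_true_iff, and_true]
    conv_lhs => rw [← (split (I (n + 1))).symm_apply_apply ω]
    exact avoids_split_symm hdisj hJ e _ _ _
  rw [sum_extend_filter (I (n + 1)) Λ' Q (fun ω => AvoidsLevels I J e ω) gB (fun _ _ => True) hE]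
  simp only [if_true, mul_one]
  have h2 : ∀ b, ∏ i ∈ I (n + 1), ∑ S, Q b i S = 1 := fun b =>
    Finset.prod_eq_one fun i hi => (hQ b i hi).2
  simp only [h2, mul_one]
  rw [Finset.sum_filter, sum_split (I (n + 1))]
  refine Finset.sum_congr rfl fun b _ => ?_
  rw [margT, Finset.sum_mul]
  refine Finset.sum_congr rfl fun a _ => ?_
  have : AvoidsLevels I J e ((split (I (n + 1))).symm (a, b)) ↔ gB b := by
    rw [hE, split_split_symm_snd]; simp
  by_cases h : gB b
  · rw [if_pos h, if_pos (this.2 h), mul_one]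
  · rw [if_neg h, if_neg (fun h' => h (this.1 h')), mul_zero]

/-- The induction hypothesis (5.2) in the form used by the nibble: `P(e ⊆ 𝐖)` via the marginal law.
[cite: FordGreenKonyaginMaynardTao2018, (5.2)] -/
theorem sum_margT_ind (hdisj : ∀ j ∈ Finset.Icc 1 n, Disjoint (I j) (I (n + 1)))
    (Λ' : (ι → Finset V) → ℝ) (e : Finset V) :
    ∑ b, margT (I (n + 1)) Λ' b * (if e ⊆ Wb I n b then (1 : ℝ) else 0) =
      ∑ ω ∈ univ.filter (fun ω => AvoidsLevels I n e ω), Λ' ω := by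
  rw [Finset.sum_filter, sum_split (I (n + 1))]
  refine Finset.sum_congr rfl fun b _ => ?_
  rw [margT, Finset.sum_mul]
  refine Finset.sum_congr rfl fun a _ => ?_
  have : AvoidsLevels I n e ((split (I (n + 1))).symm (a, b)) ↔ e ⊆ Wb I n b := by
    rw [avoids_iff_subset_Wb hdisj, split_split_symm_snd]
  by_cases h : e ⊆ Wb I n b
  · rw [if_pos h, if_pos (this.2 h), mul_one]
  · rw [if_neg h, if_neg (fun h' => h (this.1 h')), mul_zero]

end Levels

/-! ## §5, the induction on `m`: the numerology of (4.5)

At level `n + 1` put `k = 10^{n+4}`... precisely: with `x₀ = κ^A/(10e^{AD})`, (4.5) reads `δ ≤ x₀^{10^{n+3}}`;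
set `w = δ^{1/(3·10^{n+3})}`. Then `η = δ^{1/10^{n+1}} = w^{300}` (induction-hypothesis error),
`u = η^{1/6} = w^{50}`, the target error is `δ^{1/10^{n+2}} = w^{30}`, and `G w³ ≤ 1/10` for
`G = e^{AD}κ^{-A}`; hence `20G³u ≤ w^{30}`.
-/

section Numerology

variable {D A κ δ : ℝ} {n : ℕ}

/-- `w = δ^{1/(3·10^{n+3})}`. [cite: FordGreenKonyaginMaynardTao2018, §5 with (4.5)] -/
def wPar (δ : ℝ) (n : ℕ) : ℝ := δ ^ ((1 : ℝ) / (3 * (10 : ℝ) ^ (n + 3)))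

/-- `G = e^{AD} κ^{-A}`. [cite: FordGreenKonyaginMaynardTao2018, §5 with (4.5), (4.13)] -/
def Gpar (D A κ : ℝ) : ℝ := Real.exp (A * D) * κ ^ (-A)

/-- [cite: FordGreenKonyaginMaynardTao2018, §5] -/
theorem wPar_pos (hδ : 0 < δ) : 0 < wPar δ n := Real.rpow_pos_of_pos hδ _

/-- `w^N = δ^{N/(3·10^{n+3})}`. [cite: FordGreenKonyaginMaynardTao2018, §5] -/
theorem wPar_pow (hδ : 0 < δ) (N : ℕ) : wPar δ n ^ N = δ ^ ((N : ℝ) / (3 * (10 : ℝ) ^ (n + 3))) := by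
  rw [wPar, ← Real.rpow_natCast, ← Real.rpow_mul hδ.le]
  congr 1; ring

/-- `w^{300} = δ^{1/10^{n+1}}`. [cite: FordGreenKonyaginMaynardTao2018, §5] -/
theorem wPar_pow_300 (hδ : 0 < δ) : wPar δ n ^ 300 = δ ^ (1 / (10 : ℝ) ^ (n + 1)) := by
  rw [wPar_pow hδ]; congr 1; push_cast; rw [pow_succ, pow_succ]; field_simp; ring

/-- `w^{30} = δ^{1/10^{n+2}}`. [cite: FordGreenKonyaginMaynardTao2018, §5] -/
theorem wPar_pow_30 (hδ : 0 < δ) : wPar δ n ^ 30 = δ ^ (1 / (10 : ℝ) ^ (n + 1 + 1)) := by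
  rw [wPar_pow hδ]; congr 1; push_cast; rw [pow_succ, pow_succ (10 : ℝ) (n + 1)]; field_simp; ring

/-- `w^{3·10^{n+3}} = δ`. [cite: FordGreenKonyaginMaynardTao2018, §5] -/
theorem wPar_pow_all (hδ : 0 < δ) : wPar δ n ^ (3 * 10 ^ (n + 3)) = δ := by
  rw [wPar_pow hδ]
  have : ((3 * 10 ^ (n + 3) : ℕ) : ℝ) / (3 * (10 : ℝ) ^ (n + 3)) = 1 := by
    push_cast; field_simp
  rw [this, Real.rpow_one]

/-- `w³ ≤ x₀` from (4.5). [cite: FordGreenKonyaginMaynardTao2018, (4.5)] -/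
theorem wPar_cube_le (hδ : 0 < δ) {x₀ : ℝ} (hx0 : 0 ≤ x₀) (hsmall : δ ≤ x₀ ^ (10 ^ (n + 3) : ℕ)) :
    wPar δ n ^ 3 ≤ x₀ := by
  rw [wPar_pow hδ]
  have hexp : ((3 : ℕ) : ℝ) / (3 * (10 : ℝ) ^ (n + 3)) = ((10 ^ (n + 3) : ℕ) : ℝ)⁻¹ := by
    push_cast; field_simp
  rw [hexp]
  calc δ ^ (((10 ^ (n + 3) : ℕ) : ℝ)⁻¹) ≤ (x₀ ^ (10 ^ (n + 3) : ℕ)) ^ (((10 ^ (n + 3) : ℕ) : ℝ)⁻¹) :=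
        Real.rpow_le_rpow hδ.le hsmall (by positivity)
    _ = x₀ := Real.pow_rpow_inv_natCast hx0 (by positivity)

/-- `w ≤ 1`. [cite: FordGreenKonyaginMaynardTao2018, §5] -/
theorem wPar_le_one (hδ : 0 < δ) (hδ1 : δ ≤ 1) : wPar δ n ≤ 1 :=
  Real.rpow_le_one hδ.le hδ1 (by positivity)

/-- `1 ≤ G`, indeed `e^{AD} ≤ G` and `κ^{-A} ≤ G`. [cite: FordGreenKonyaginMaynardTao2018, §5] -/
theorem Gpar_bounds (hD : 1 ≤ D) (hA : 1 ≤ A) (hκ0 : 0 < κ) (hκ : κ ≤ 1 / 2) :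
    1 ≤ Real.exp (A * D) ∧ 1 ≤ κ ^ (-A) ∧ Real.exp (A * D) ≤ Gpar D A κ ∧ κ ^ (-A) ≤ Gpar D A κ ∧
      A * D ≤ Gpar D A κ := by
  have h1 : 1 ≤ Real.exp (A * D) := Real.one_le_exp (by positivity)
  have h2 : 1 ≤ κ ^ (-A) := Real.one_le_rpow_of_pos_of_le_one_of_nonpos hκ0 (by linarith) (by linarith)
  have h3 : A * D ≤ Real.exp (A * D) := by linarith [Real.add_one_le_exp (A * D)]
  refine ⟨h1, h2, ?_, ?_, ?_⟩ <;> unfold Gpar <;> nlinarith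

/-- `G x₀ = 1/10`. [cite: FordGreenKonyaginMaynardTao2018, (4.5)] -/
theorem Gpar_mul_x0 (hκ0 : 0 < κ) : Gpar D A κ * (κ ^ A / (10 * Real.exp (A * D))) = 1 / 10 := by
  unfold Gpar
  have h1 : κ ^ (-A) * κ ^ A = 1 := by
    rw [Real.rpow_neg hκ0.le, inv_mul_cancel₀ (Real.rpow_pos_of_pos hκ0 A).ne']
  have h2 := Real.exp_pos (A * D)
  field_simp
  linear_combination h1

/-- **`G w³ ≤ 1/10`.** [cite: FordGreenKonyaginMaynardTao2018, (4.5)] -/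
theorem Gpar_wPar_cube_le (hD : 1 ≤ D) (hA : 1 ≤ A) (hκ0 : 0 < κ) (hκ : κ ≤ 1 / 2) (hδ : 0 < δ)
    (hsmall : δ ≤ (κ ^ A / (10 * Real.exp (A * D))) ^ (10 ^ (n + 3) : ℕ)) :
    Gpar D A κ * wPar δ n ^ 3 ≤ 1 / 10 := by
  obtain ⟨hx0, _⟩ := x0_pos_le_one (D := D) hD hA hκ0 hκ
  have h := wPar_cube_le hδ hx0.le hsmall
  have hG : 0 ≤ Gpar D A κ := by
    have := (Gpar_bounds hD hA hκ0 hκ).1; have := (Gpar_bounds hD hA hκ0 hκ).2.2.1; linarith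
  calc Gpar D A κ * wPar δ n ^ 3 ≤ Gpar D A κ * (κ ^ A / (10 * Real.exp (A * D))) :=
        mul_le_mul_of_nonneg_left h hG
    _ = 1 / 10 := Gpar_mul_x0 hκ0

/-- The smallness facts the nibble needs, from (4.5): `δ ≤ 1`, `δ ≤ η^{10}`, `G¹⁸ η 10¹² ≤ 1`,
`20 G³ w^{50} ≤ w^{30}` (`η = w^{300}`). [cite: FordGreenKonyaginMaynardTao2018, §5 with (4.5)] -/
theorem smallness (hD : 1 ≤ D) (hA : 1 ≤ A) (hκ0 : 0 < κ) (hκ : κ ≤ 1 / 2) (hδ : 0 < δ)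
    (hsmall : δ ≤ (κ ^ A / (10 * Real.exp (A * D))) ^ (10 ^ (n + 3) : ℕ)) :
    δ ≤ 1 ∧ δ ≤ (wPar δ n ^ 300) ^ 10 ∧ Gpar D A κ ^ 18 * wPar δ n ^ 300 * 10 ^ 12 ≤ 1 ∧
      20 * (Gpar D A κ ^ 3 * wPar δ n ^ 50) ≤ wPar δ n ^ 30 := by
  obtain ⟨hx0, hx1⟩ := x0_pos_le_one (D := D) hD hA hκ0 hκ
  have hδ1 : δ ≤ 1 := hsmall.trans (pow_le_one₀ hx0.le hx1)
  have hw0 := wPar_pos (n := n) hδ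
  have hw1 := wPar_le_one (n := n) hδ hδ1
  have hGw := Gpar_wPar_cube_le hD hA hκ0 hκ hδ hsmall
  have hG1 : 1 ≤ Gpar D A κ := by
    have := (Gpar_bounds hD hA hκ0 hκ).1; have := (Gpar_bounds hD hA hκ0 hκ).2.2.1; linarith
  set w := wPar δ n with hw
  set G := Gpar D A κ with hG
  refine ⟨hδ1, ?_, ?_, ?_⟩
  · -- δ = w^{3·10^{n+3}} ≤ w^{3000}
    rw [← pow_mul, ← wPar_pow_all (n := n) hδ]
    exact pow_le_pow_of_le_one hw0.le hw1 (by
      have : 1000 ≤ 10 ^ (n + 3) := by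
        calc (1000 : ℕ) = 10 ^ 3 := by norm_num
          _ ≤ 10 ^ (n + 3) := Nat.pow_le_pow_right (by norm_num) (by omega)
      omega)
  · have h1 : G ^ 18 * w ^ 300 * 10 ^ 12 ≤ G ^ 18 * w ^ 54 * 10 ^ 12 := by
      have : w ^ 300 ≤ w ^ 54 := pow_le_pow_of_le_one hw0.le hw1 (by norm_num)
      have : 0 ≤ G ^ 18 := by positivity
      nlinarith
    have h2 : G ^ 18 * w ^ 54 = (G * w ^ 3) ^ 18 := by ring
    have h3 : (G * w ^ 3) ^ 18 ≤ (1 / 10) ^ 18 := pow_le_pow_left₀ (by positivity) hGw 18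
    rw [h2] at h1
    nlinarith
  · have h1 : 20 * (G ^ 3 * w ^ 50) = 20 * (G * w ^ 3) ^ 3 * w ^ 41 := by ring
    have h2 : (G * w ^ 3) ^ 3 ≤ (1 / 10) ^ 3 := pow_le_pow_left₀ (by positivity) hGw 3
    have h3 : w ^ 41 ≤ w ^ 30 := pow_le_pow_of_le_one hw0.le hw1 (by norm_num)
    have h4 : 0 ≤ w ^ 41 := by positivity
    rw [h1]
    nlinarith

end Numerology

/-! ## §5, the induction on `m`: the nibble at level `n + 1`, and the proof of Theorem 3 -/

section Induction

variable {V ι : Type*} [Fintype V] [DecidableEq V] [Fintype ι] [DecidableEq ι]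
variable {D r A κ δ : ℝ} {I : ℕ → Finset ι} {μ : ι → Finset V → ℝ} {n : ℕ}

namespace LevelHyps

omit [Fintype V] [DecidableEq V] [Fintype ι] [DecidableEq ι] in
/-- [cite: FordGreenKonyaginMaynardTao2018, Theorem 3] -/
theorem mem_top (n : ℕ) : n + 1 ∈ Finset.Icc 1 (n + 1) := by
  rw [Finset.mem_Icc]; omega

omit [Fintype ι] [DecidableEq ι] in
/-- [cite: FordGreenKonyaginMaynardTao2018, Theorem 3] -/
theorem disj_top (H : LevelHyps D r A κ δ I μ (n + 1)) :
    ∀ j ∈ Finset.Icc 1 n, Disjoint (I j) (I (n + 1)) := fun j hj => by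
  rw [Finset.mem_Icc] at hj
  exact H.hdisj j (by rw [Finset.mem_Icc]; omega) (n + 1) (mem_top n) (by omega)

omit [Fintype ι] [DecidableEq ι] in
/-- (4.7) implies `P(v ∈ 𝐞_i) ≤ δ`. [cite: FordGreenKonyaginMaynardTao2018, (4.7)] -/
theorem sparse_top (H : LevelHyps D r A κ δ I μ (n + 1)) :
    ∀ i ∈ I (n + 1), ∀ v : V, probMem (μ i) v ≤ δ := fun i hi v => by
  refine (H.hsparse (n + 1) (mem_top n) i hi v).trans (div_le_self H.hδ.le ?_)
  rw [Real.one_le_sqrt]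
  exact_mod_cast (H.hne (n + 1) (mem_top n)).card_pos

omit [Fintype ι] [DecidableEq ι] in
/-- [cite: FordGreenKonyaginMaynardTao2018, Theorem 3] -/
theorem μ_nonneg_low (H : LevelHyps D r A κ δ I μ (n + 1)) :
    ∀ j' ∈ Finset.Icc 1 n, ∀ i ∈ I j', ∀ S : Finset V, 0 ≤ μ i S := fun j' hj' i hi S => by
  rw [Finset.mem_Icc] at hj'
  exact (H.hlaw j' (by rw [Finset.mem_Icc]; omega) i hi).1 S

omit [Fintype ι] [DecidableEq ι] in
/-- `κ^r ≤ P_n(S)` on the essential range ((4.6), (4.13)). [cite: FordGreenKonyaginMaynardTao2018, §5 (first display)] -/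
theorem θ_le (H : LevelHyps D r A κ δ I μ (n + 1)) {i : ι} (hi : i ∈ I (n + 1)) {S : Finset V}
    (hS : μ i S ≠ 0) : κ ^ r ≤ pw (levelProb μ I n) S := by
  have h1 : κ ^ (#S) ≤ pw (levelProb μ I n) S :=
    pow_card_le_pw H.hκ0.le (fun v => H.hκp n (by omega) v) S
  have h2 : κ ^ r ≤ κ ^ ((#S : ℕ) : ℝ) :=
    Real.rpow_le_rpow_of_exponent_ge H.hκ0 (by linarith [H.hκ]) (H.hsize (n + 1) (mem_top n) i hi S hS)
  rw [Real.rpow_natCast] at h2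
  exact h2.trans h1

omit [Fintype ι] [DecidableEq ι] in
/-- `1/P_n(e) ≤ κ^{-A} ≤ G` for `#e ≤ A` ((4.13)). [cite: FordGreenKonyaginMaynardTao2018, (4.13)] -/
theorem inv_pw_le_G (H : LevelHyps D r A κ δ I μ (n + 1)) {e : Finset V} (he : (#e : ℝ) ≤ A) :
    1 / pw (levelProb μ I n) e ≤ Gpar D A κ := by
  have h1 : κ ^ (#e) ≤ pw (levelProb μ I n) e :=
    pow_card_le_pw H.hκ0.le (fun v => H.hκp n (by omega) v) e
  have h2 : κ ^ A ≤ κ ^ ((#e : ℕ) : ℝ) :=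
    Real.rpow_le_rpow_of_exponent_ge H.hκ0 (by linarith [H.hκ]) he
  rw [Real.rpow_natCast] at h2
  have h3 : 0 < κ ^ A := Real.rpow_pos_of_pos H.hκ0 A
  calc 1 / pw (levelProb μ I n) e ≤ 1 / κ ^ A := one_div_le_one_div_of_le h3 (h2.trans h1)
    _ = κ ^ (-A) := by rw [Real.rpow_neg H.hκ0.le, one_div]
    _ ≤ Gpar D A κ := (Gpar_bounds H.hD H.hA H.hκ0 H.hκ).2.2.2.1

omit [Fintype ι] [DecidableEq ι] in
/-- `κ^{-r} ≤ G` when `r ≤ A`. [cite: FordGreenKonyaginMaynardTao2018, §5] -/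
theorem inv_θ_le_G (H : LevelHyps D r A κ δ I μ (n + 1)) (hrA : r ≤ A) : (κ ^ r)⁻¹ ≤ Gpar D A κ := by
  rw [← Real.rpow_neg H.hκ0.le]
  exact (Real.rpow_le_rpow_of_exponent_ge H.hκ0 (by linarith [H.hκ]) (by linarith)).trans
    (Gpar_bounds H.hD H.hA H.hκ0 H.hκ).2.2.2.1

/-- The induction hypothesis (5.2) for the marginal law. [cite: FordGreenKonyaginMaynardTao2018, (5.2)] -/
theorem nibble_hyp (H : LevelHyps D r A κ δ I μ (n + 1)) (Λ' : (ι → Finset V) → ℝ)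
    (hIH : ∀ e : Finset V, (#e : ℝ) ≤ A - 2 * r * (n : ℝ) →
      |(∑ ω ∈ univ.filter (fun ω => AvoidsLevels I n e ω), Λ' ω) - levelProbSet μ I n e| ≤
        δ ^ (1 / (10 : ℝ) ^ (n + 1)) * levelProbSet μ I n e) :
    ∀ e : Finset V, (#e : ℝ) ≤ A - 2 * r * ((n : ℝ) + 1) + 2 * r →
      |(∑ b, margT (I (n + 1)) Λ' b * if e ⊆ Wb I n b then (1 : ℝ) else 0) -
          pw (levelProb μ I n) e| ≤ wPar δ n ^ 300 * pw (levelProb μ I n) e := by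
  intro e he
  have h := hIH e (by linarith)
  rwa [← sum_margT_ind H.disj_top Λ' e, levelProbSet_eq_pw, ← wPar_pow_300 H.hδ] at h

end LevelHyps

/-- **The nibble at level `n + 1`** as a `NibbleData` (non-degenerate case `A ≥ 2r(n+1)`): block
`T = I_{n+1}`, weights `P_n`, previous stage = the marginal of `Λ'` off `T` with `𝐖` of (5.1),
`s = A − 2r(n+1)`, `η = δ^{1/10^{n+1}}`, `θ = κ^r`, `G = e^{AD}κ^{-A}`.
[cite: FordGreenKonyaginMaynardTao2018, §5 pp. 19–21] -/
def mkNibble (H : LevelHyps D r A κ δ I μ (n + 1)) (hs : 0 ≤ A - 2 * r * ((n : ℝ) + 1))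
    {Λ' : (ι → Finset V) → ℝ} (hΛ : IsLaw Λ')
    (hIH : ∀ e : Finset V, (#e : ℝ) ≤ A - 2 * r * (n : ℝ) →
      |(∑ ω ∈ univ.filter (fun ω => AvoidsLevels I n e ω), Λ' ω) - levelProbSet μ I n e| ≤
        δ ^ (1 / (10 : ℝ) ^ (n + 1)) * levelProbSet μ I n e) :
    NibbleData V ι ({x // x ∉ I (n + 1)} → Finset V) where
  T := I (n + 1)
  μ := μ
  p := levelProb μ I n
  Λ := margT (I (n + 1)) Λ'
  W := Wb I n
  r := r
  s := A - 2 * r * ((n : ℝ) + 1)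
  δ := δ
  η := wPar δ n ^ 300
  κ := κ
  θ := κ ^ r
  D := D
  G := Gpar D A κ
  hlaw := fun i hi => H.hlaw (n + 1) (LevelHyps.mem_top n) i hi
  hsize := fun i hi => H.hsize (n + 1) (LevelHyps.mem_top n) i hi
  hsparse := H.sparse_top
  hcodeg := H.hcodeg (n + 1) (LevelHyps.mem_top n)
  hdeg := fun v => by simpa using H.hdeg (n + 1) (LevelHyps.mem_top n) v
  hpκ := fun v => H.hκp n (by omega) v
  hp1 := levelProb_le_one n H.μ_nonneg_low
  hθ := fun _ hi _ hS => H.θ_le hi hS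
  hθκ := by
    have := Real.rpow_le_rpow_of_exponent_ge H.hκ0 (by linarith [H.hκ]) H.hr
    rwa [Real.rpow_one] at this
  hΛ := margT_isLaw _ hΛ
  hhyp := H.nibble_hyp Λ' hIH
  hr := H.hr
  hs := hs
  hδ := H.hδ
  hη0 := pow_pos (wPar_pos H.hδ) 300
  hκ := H.hκ0
  hθ0 := Real.rpow_pos_of_pos H.hκ0 r
  hD := H.hD
  hG := by
    have := (Gpar_bounds H.hD H.hA H.hκ0 H.hκ).1
    have := (Gpar_bounds H.hD H.hA H.hκ0 H.hκ).2.2.1; linarith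
  hsG := by
    have := (Gpar_bounds H.hD H.hA H.hκ0 H.hκ).2.2.2.2
    have : 0 ≤ 2 * r * ((n : ℝ) + 1) := by have := H.hr; positivity
    have : A ≤ A * D := by have := H.hA; have := H.hD; nlinarith
    linarith
  hDG := by
    have := (Gpar_bounds H.hD H.hA H.hκ0 H.hκ).2.2.2.2
    have : D ≤ A * D := by have := H.hA; have := H.hD; nlinarith
    linarith
  hrG := by
    have := (Gpar_bounds H.hD H.hA H.hκ0 H.hκ).2.2.2.2
    have : A ≤ A * D := by have := H.hA; have := H.hD; nlinarith
    have : r ≤ 2 * r * ((n : ℝ) + 1) := by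
      have := H.hr; have : (0 : ℝ) ≤ n := Nat.cast_nonneg n; nlinarith
    linarith
  hθG := H.inv_θ_le_G (by
    have : r ≤ 2 * r * ((n : ℝ) + 1) := by
      have := H.hr; have : (0 : ℝ) ≤ n := Nat.cast_nonneg n; nlinarith
    linarith)
  hexpG := by
    refine le_trans (Real.exp_le_exp.2 ?_) (Gpar_bounds H.hD H.hA H.hκ0 H.hκ).2.2.1
    have : 0 ≤ 2 * r * ((n : ℝ) + 1) := by have := H.hr; positivity
    have := H.hD
    nlinarith
  hPG := fun e he => H.inv_pw_le_G (by
    have : 0 ≤ 2 * r * ((n : ℝ) + 1) := by have := H.hr; positivity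
    linarith)
  hδη := (smallness H.hD H.hA H.hκ0 H.hκ H.hδ H.hsmall).2.1
  hGη := (smallness H.hD H.hA H.hκ0 H.hκ H.hδ H.hsmall).2.2.1

/-- `u = η^{1/6} = w^{50}` for the nibble at level `n + 1`. [cite: FordGreenKonyaginMaynardTao2018, §5] -/
theorem mkNibble_u (H : LevelHyps D r A κ δ I μ (n + 1)) (hs : 0 ≤ A - 2 * r * ((n : ℝ) + 1))
    {Λ' : (ι → Finset V) → ℝ} (hΛ : IsLaw Λ')
    (hIH : ∀ e : Finset V, (#e : ℝ) ≤ A - 2 * r * (n : ℝ) →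
      |(∑ ω ∈ univ.filter (fun ω => AvoidsLevels I n e ω), Λ' ω) - levelProbSet μ I n e| ≤
        δ ^ (1 / (10 : ℝ) ^ (n + 1)) * levelProbSet μ I n e) :
    (mkNibble H hs hΛ hIH).u = wPar δ n ^ 50 := by
  rw [NibbleData.u]
  show (wPar δ n ^ 300) ^ (1 / 6 : ℝ) = wPar δ n ^ 50
  rw [show wPar δ n ^ 300 = (wPar δ n ^ 50) ^ 6 by ring, ← Real.rpow_natCast (wPar δ n ^ 50) 6,
    ← Real.rpow_mul (pow_nonneg (wPar_pos H.hδ).le 50)]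
  norm_num

/-- `q(S) 1_{e ∩ S = ∅}` versus the `Y`-summand. [cite: FordGreenKonyaginMaynardTao2018, §5] -/
theorem mul_ite_avoid_eq (q : ℝ) (S e : Finset V) :
    (q * if (∀ v ∈ e, v ∉ S) then (1 : ℝ) else 0) = if (S ∩ e).Nonempty then 0 else q := by
  by_cases hne : (S ∩ e).Nonempty
  · obtain ⟨v, hv⟩ := hne
    rw [Finset.mem_inter] at hv
    rw [if_neg (fun h => h v hv.2 hv.1), if_pos ⟨v, Finset.mem_inter.2 hv⟩, mul_zero]
  · rw [if_neg hne, if_pos (fun v hv hvS => hne ⟨v, Finset.mem_inter.2 ⟨hvS, hv⟩⟩), mul_one]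

/-- **The inductive step `n → n + 1` of Theorem 3.** [cite: FordGreenKonyaginMaynardTao2018, §5 pp. 19–21] -/
theorem levelConcl_succ (H : LevelHyps D r A κ δ I μ (n + 1)) (hC : LevelConcl r A δ I μ n) :
    LevelConcl r A δ I μ (n + 1) := by
  obtain ⟨Λ', hΛ, ha, hb⟩ := hC
  have hdisj := H.disj_top
  by_cases hs : 0 ≤ A - 2 * r * ((n : ℝ) + 1)
  · -- the nibble
    let 𝔑 := mkNibble H hs hΛ (hb n le_rfl)
    let Q : ({x // x ∉ I (n + 1)} → Finset V) → ι → Finset V → ℝ := fun b => 𝔑.q (𝔑.W b)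
    have hQlaw : ∀ b, ∀ i ∈ I (n + 1), IsLaw (Q b i) := fun b i hi => 𝔑.q_isLaw hi _
    refine ⟨extend (I (n + 1)) Λ' Q, extend_isLaw _ hΛ hQlaw, ?_, ?_⟩
    · intro ω hω
      exact extend_support hdisj ha (fun b i _ S hS => 𝔑.q_support hS) ω hω
    · intro J hJ e he
      by_cases hJn : J ≤ n
      · rw [sum_extend_avoids_of_le hdisj Λ' hQlaw hJn]
        exact hb J hJn e he
      · have hJ' : J = n + 1 := by omega
        subst hJ'
        have he' : (#e : ℝ) ≤ 𝔑.s := by push_cast at he; exact he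
        have hE : ∀ ω : ι → Finset V, AvoidsLevels I (n + 1) e ω ↔
            (e ⊆ Wb I n (split (I (n + 1)) ω).2) ∧ ∀ i ∈ I (n + 1), ∀ v ∈ e, v ∉ ω i := by
          intro ω; rw [avoids_succ_iff, avoids_iff_subset_Wb hdisj]
        have hsum : ∑ ω ∈ univ.filter (fun ω => AvoidsLevels I (n + 1) e ω),
            extend (I (n + 1)) Λ' Q ω = 𝔑.E (fun b => 𝔑.ind e b * 𝔑.Y e (𝔑.W b)) := by
          rw [sum_extend_filter (I (n + 1)) Λ' Q (fun ω => AvoidsLevels I (n + 1) e ω)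
            (fun b => e ⊆ Wb I n b) (fun _ S => ∀ v ∈ e, v ∉ S) hE]
          simp only [NibbleData.E, NibbleData.ind, NibbleData.Y, mul_assoc]
          refine Finset.sum_congr rfl fun b _ => ?_
          congr 2
          refine Finset.prod_congr rfl fun i _ => Finset.sum_congr rfl fun S _ => ?_
          exact mul_ite_avoid_eq _ S e
        rw [hsum, levelProbSet_succ n e]
        refine (𝔑.step he').trans ?_
        have hsmall := (smallness (n := n) H.hD H.hA H.hκ0 H.hκ H.hδ H.hsmall).2.2.2
        have hE0 : 20 * 𝔑.E0 ≤ δ ^ (1 / (10 : ℝ) ^ (n + 1 + 1)) := by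
          rw [NibbleData.E0, mkNibble_u, ← wPar_pow_30 H.hδ]
          exact hsmall
        exact mul_le_mul_of_nonneg_right hE0 (mul_pos (𝔑.P_pos e) (Real.exp_pos _)).le
  · -- degenerate case `A < 2r(n+1)`: put `𝐞'_i = ∅` on the block
    let Q : ({x // x ∉ I (n + 1)} → Finset V) → ι → Finset V → ℝ :=
      fun _ _ S => if S = ∅ then 1 else 0
    have hQlaw : ∀ b, ∀ i ∈ I (n + 1), IsLaw (Q b i) := fun b i _ =>
      ⟨fun S => by simp only [Q]; split_ifs <;> norm_num, by simp [Q]⟩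
    refine ⟨extend (I (n + 1)) Λ' Q, extend_isLaw _ hΛ hQlaw, ?_, ?_⟩
    · intro ω hω
      refine extend_support hdisj ha (fun b i _ S hS => Or.inl ?_) ω hω
      by_contra h
      exact hS (by simp [Q, h])
    · intro J hJ e he
      by_cases hJn : J ≤ n
      · rw [sum_extend_avoids_of_le hdisj Λ' hQlaw hJn]
        exact hb J hJn e he
      · exfalso
        have hJ' : J = n + 1 := by omega
        subst hJ'
        push_cast at he
        have : (0 : ℝ) ≤ #e := Nat.cast_nonneg _
        linarith

omit [Fintype ι] [DecidableEq ι] in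
/-- **The base case `m = 0` of Theorem 3** (all `𝐞'_i`... there are none; point mass).
[cite: FordGreenKonyaginMaynardTao2018, §5 («when `m = 0` there is nothing to prove»)] -/
theorem levelConcl_zero [Fintype ι] [DecidableEq ι] (hδ : 0 ≤ δ) : LevelConcl r A δ I μ 0 := by
  refine ⟨fun ω => if ω = fun _ => ∅ then 1 else 0,
    ⟨fun ω => by by_cases h : ω = (fun _ => ∅) <;> simp [h], by simp⟩,
    fun ω _ j hj => by rw [Finset.mem_Icc] at hj; omega, fun J hJ e _ => ?_⟩
  have hJ0 : J = 0 := by omega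
  subst hJ0
  have hav : ∀ ω : ι → Finset V, AvoidsLevels I 0 e ω := fun ω v _ j hj => by
    rw [Finset.mem_Icc] at hj; omega
  have h1 : ∑ ω ∈ univ.filter (fun ω => AvoidsLevels I 0 e ω),
      (if ω = fun _ => ∅ then (1 : ℝ) else 0) = 1 := by
    rw [Finset.filter_true_of_mem (fun ω _ => hav ω)]; simp
  have h2 : levelProbSet μ I 0 e = 1 := by simp [levelProbSet, levelProb]
  rw [h1, h2, sub_self, abs_zero, mul_one]
  exact Real.rpow_nonneg hδ _

/-- **Theorem 3 at every level `m`**, by induction on `m`. [cite: FordGreenKonyaginMaynardTao2018, §5] -/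
theorem levelConcl_of_levelHyps : ∀ (m : ℕ), LevelHyps D r A κ δ I μ m → LevelConcl r A δ I μ m
  | 0, H => levelConcl_zero H.hδ.le
  | m + 1, H => levelConcl_succ H (levelConcl_of_levelHyps m H.mono)

end Induction

/-- **Theorem 3 holds with `C₀ = 10`.** [cite: FordGreenKonyaginMaynardTao2018, Theorem 3] -/
theorem theorem3With_ten : Theorem3With 10 := by
  intro V ι _ _ _ _ D r A κ δ m I μ hD hr hA hκ0 hκ hδ hsmall hne hdisj hlaw hsize hsparse hcodeg hdeg hκp
  exact levelConcl_of_levelHyps m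
    ⟨hD, hr, hA, hκ0, hκ, hδ, hsmall, hne, hdisj, hlaw, hsize, hsparse, hcodeg, hdeg, hκp⟩

end FGKMTCovering

/-- **Ford–Green–Konyagin–Maynard–Tao 2018, Theorem 3 (Probabilistic covering) — PROVED**, with the
explicit constant `C₀ = 10`. [cite: FordGreenKonyaginMaynardTao2018, Theorem 3; §5 pp. 19–21] -/
theorem fgkmt2018_theorem3 : FGKMT2018_theorem3 :=
  ⟨10, by norm_num, FGKMTCovering.theorem3With_ten⟩


end Literature.Combinatorics.Hypergraph
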